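import Mathlib
import HarnessLib
import Summits.HubbardSuperconductivity.HubbardSuperconductivity.Theorems.KLProgrammeKLRegimeTwoVolumeTorusBlocks
import Summits.HubbardSuperconductivity.HubbardSuperconductivity.Theorems.KLProgrammeKLRegimeTwoVolumeProfileBridge
import Summits.HubbardSuperconductivity.HubbardSuperconductivity.Theorems.KLProgrammeKLRegimeEngineE4ScaleDoor

/-!
# Route `KLProgramme` — crux K3 ENGINE (stmt-HubbardSuperconductivity-20437), stub (e) proof-input «(e)-D-ROWS», (M1): THE ADMISSIBLE CONSTANT OF THE
# ZONE BRACKET IN THE MODEL'S GEOMETRY — the engine's tree weight `klScaleWt` at a label set joining a deep pin to the seam zone is `≥ 1 + Λ_n·(ρ+1)`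
# (seat hubbard-kl-k3c4-p1 g22; `--supports` 20437; DROWS-SCOPE-g22 §7.2 (ii), §8 «admissibility row»)

The graded zone doors (`Literature/…/GrassmannCumulantPolarisedGradedZoneDB`, `…GrassmannEffectiveActionGradedZoneLipschitzDB`, `…GrassmannGaussConvBinomialZone`)
take a constant `Λ` with `Λ ≤ wt S` for every label set `S` containing the output pin `w` and a label of the zone `Z`.  In the nested two-volume comparison
(fine torus of side `L = b·m` against `b²` boxes `≅` the coarse torus of side `m`) the zone at block `k` is `Z_k = {labels whose site is NOT r_k-deep in its
box}` and the output pins are `(r_k + ρ_k)`-deep; the engine's tree weight is `klScaleWt L M β n S = 1 + Λ_n·diam_d(S)`, `d = gridLabelDist` (time circle +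
periodic `ℓ^∞` on the sites), `Λ_n = klScale klE0 n`.  A site that is not `R`-deep and a site that is `(R+R′)`-deep are at torus distance `> R′`
(`…TwoVolumeTorusBlocks.far_of_not_deep_of_deep`), so:

* `cyclicDist_nonneg'`, `torusSiteDist_le_gridLabelDist` — the grid label distance dominates the spatial torus distance (`β ≥ 0`);
* `succ_le_torusSiteDist_of_not_deep_of_deep` — `R′ + 1 ≤ torusSiteDist x w` for `x` not `R`-deep, `w` `(R+R′)`-deep;
* **`klScaleWt_ge_of_deep_of_not_deep`** — for a label set `S ∋ a, z` with `a` `(R+R′)`-deep and `z` not `R`-deep (sites read in their boxes of side `m`):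
  `1 + klScale klE0 n · (R′ + 1) ≤ klScaleWt L M β n S` — the admissibility row with **`Λ_k = 1 + Λ_{J_{k+1}}·(ρ_k + 1)`**, zone `Z_k = (r_k-deep)ᶜ`,
  pins `(r_k + ρ_k)`-deep.

Everything is proved; no definition.  Nothing about the flow is asserted; nothing asserts the (D) rows, stub (e), VL, K3 or superconductivity.
References: Benfatto–Giuliani–Mastropietro 2006 §3 (3.2)–(3.8) (position-space decay bookkeeping) [cite: BenfattoGiulianiMastropietro2006].
-/

noncomputable section

namespace Summit.HubbardSuperconductivity.HubbardSuperconductivity.Theorems.TwoVolumeDefect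

set_option linter.dupNamespace false -- summit = problem name (single-conjunct summit), D-0017

open Real Finset Literature.MathematicalPhysics.QuantumLattice Literature.Probability.LatticeModels Literature.Probability.LatticeModels.BattleFederbush
open Summit.HubbardSuperconductivity.HubbardSuperconductivity.Theorems.EngineV8
open Summit.HubbardSuperconductivity.HubbardSuperconductivity.Theorems.KLRegimeSplit
open Summit.HubbardSuperconductivity.HubbardSuperconductivity.Theorems.KLProgrammeLegKernels

/-! ## §1 The grid label distance dominates the spatial torus distance -/

/-- The cyclic (time) distance is nonnegative. -/
theorem cyclicDist_nonneg' (n : ℕ) (a b : ZMod n) : 0 ≤ cyclicDist n a b := by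
  unfold cyclicDist; positivity

/-- **The grid label distance dominates the spatial torus distance** (`β ≥ 0`). -/
theorem torusSiteDist_le_gridLabelDist {L Ng : ℕ} {β : ℝ} (hβ : 0 ≤ β) (a z : ZMod Ng × TorusSite 2 L) :
    torusSiteDist a.2 z.2 ≤ gridLabelDist L Ng β a z := by
  unfold gridLabelDist
  have : 0 ≤ β / Ng * cyclicDist Ng a.1 z.1 := mul_nonneg (div_nonneg hβ (Nat.cast_nonneg _)) (cyclicDist_nonneg' Ng a.1 z.1)
  linarith

/-! ## §2 A zone site is far from a deep pin -/

/-- **`R′ + 1 ≤ torusSiteDist x w`** for a site `x` that is NOT `R`-deep in its box and a site `w` that is `(R + R′)`-deep (boxes of side `m`, torus of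
side `L = b·m`; `…TwoVolumeTorusBlocks.far_of_not_deep_of_deep` read as reals). -/
theorem succ_le_torusSiteDist_of_not_deep_of_deep {d L b m : ℕ} [NeZero L] [NeZero m] (hL : L = b * m) {R R' : ℕ} {x w : TorusSite d L}
    (hx : ¬ ∀ j, R ≤ (x j).val % m ∧ (x j).val % m + R < m) (hw : ∀ j, R + R' ≤ (w j).val % m ∧ (w j).val % m + (R + R') < m) :
    (R' : ℝ) + 1 ≤ torusSiteDist x w := by
  have h := far_of_not_deep_of_deep (d := d) hL hx hw
  have hcast : (((R' + 1 : ℕ)) : ℝ) ≤ (Torus.tnorm (x - w) : ℝ) := by exact_mod_cast h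
  rw [tnorm_sub_eq_torusSiteDist] at hcast
  push_cast at hcast
  exact hcast

/-! ## §3 The admissibility row of the zone bracket -/

/-- **THE ENGINE'S TREE WEIGHT AT A LABEL SET JOINING A DEEP PIN TO THE SEAM ZONE**: for `β ≥ 0`, a label set `S` of the `4M`-grid bookkeeping containing
a label `a` whose site is `(R + R′)`-deep in its box and a label `z` whose site is NOT `R`-deep (boxes of side `m`, torus `L = b·m`),
`1 + klScale klE0 n · (R′ + 1) ≤ klScaleWt L M β n S`.  With `R = r_k`, `R′ = ρ_k`, `n = J_{k+1}` this is the admissible constant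
`Λ_k = 1 + Λ_{J_{k+1}}·(ρ_k + 1)` of the zone bracket of the two-volume Lipschitz tower (DROWS-SCOPE-g22 §7.2). -/
theorem klScaleWt_ge_of_deep_of_not_deep {L b m : ℕ} [NeZero L] [NeZero m] (hL : L = b * m) (M : ℕ) {β : ℝ} (hβ : 0 ≤ β) (n : ℕ) {R R' : ℕ}
    {S : Finset (ZMod (2 * (2 * M)) × TorusSite 2 L)} {a z : ZMod (2 * (2 * M)) × TorusSite 2 L} (ha : a ∈ S) (hz : z ∈ S)
    (hw : ∀ j, R + R' ≤ (a.2 j).val % m ∧ (a.2 j).val % m + (R + R') < m)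
    (hx : ¬ ∀ j, R ≤ (z.2 j).val % m ∧ (z.2 j).val % m + R < m) :
    1 + klScale klE0 n * ((R' : ℝ) + 1) ≤ klScaleWt L M β n S := by
  rw [klScaleWt_apply]
  have hΛ : 0 ≤ klScale klE0 n := (klth_klScale_pos n).le
  have hd : (R' : ℝ) + 1 ≤ labelDiam (gridLabelDist L (2 * (2 * M)) β) S :=
    ((succ_le_torusSiteDist_of_not_deep_of_deep (d := 2) hL hx hw).trans (torusSiteDist_le_gridLabelDist hβ z a)).trans
      (le_labelDiam _ hz ha)
  have := mul_le_mul_of_nonneg_left hd hΛ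
  linarith

end Summit.HubbardSuperconductivity.HubbardSuperconductivity.Theorems.TwoVolumeDefect

end
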